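import Mathlib
import HarnessLib
import Summits.HubbardSuperconductivity.HubbardSuperconductivity.Theorems.KLProgrammeKLRegimeCountertermJacksonRemainderFlow
import Summits.HubbardSuperconductivity.HubbardSuperconductivity.Theorems.KLProgrammeKLRegimeSplitCompGradedBounds

/-!
# Route `KLProgramme`, crux K3 — gen-8 ENGINE-FLOW child (stmt-HubbardSuperconductivity-20437 `KLRegimeEngineV17F2`), stub (C)
# `stub_twoLeg_curvature`, door (C1) part 4: the LOCAL SIZES `Ml` of the G-extension in sharp forms (Θ-form, Bell-GRADED) and the ball
# geometry that puts the `r`-ball about the curve point inside the open flat tube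

Seat hubbard-kl-k3c3-p1 (g5).  Part 3 (`…JacksonRemainderFlow`) reads LOCAL sizes `‖Dⁱ(onM (klFrameExtFn μ f))(y)‖ ≤ Ml i` on the ball `‖y − γθ‖ ≤ r`
and proves them in the single-constant radius form `n!·G·((n−1)!/ρ)ⁿ` (= `31104·G/ρ⁴` at order 4).  Here:

* §1 the `Θ`-form `n!·G·Θⁿ` under `(i−1)!/‖y‖ⁱ ≤ Θⁱ` (`norm_iteratedFDeriv_onM_klFrameExtFn_le_near_theta`) and its order-4 radius instance
  `144·G/ρ⁴` (`norm_iteratedFDeriv_four_onM_klFrameExtFn_le_near`);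
* §2 the BELL-GRADED form (`…SplitCompGradedBounds`, p535081): **`norm_iteratedFDeriv_onM_klFrameExtFn_le_near_graded`** —
  `a₁/ρ | (a₂ + a₁)/ρ² | (a₃ + 3a₂ + 2a₁)/ρ³ | (a₄ + 6a₃ + 11a₂ + 6a₁)/ρ⁴` from `‖Dᵏf‖ ≤ a k` (`1 ≤ k ≤ 4`; the mean drops out), the right
  currency for the GRADED jets of the flow readings (`a₁ ∝ 4^{−n}`, `a₄ ∝ 16ⁿ`);
* §3 ball geometry: `abs_sqDispersion_sub_lt_of_ball` (`|ε(x) − μ| + 4r < 1/20 ⇒` the `r`-ball about `x` is in the open flat tube, `‖Dε‖ ≤ 4`),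
  `abs_coord_lt_pi_of_ball`, `le_norm_of_ball`; §4 **`localSizes_onM_klFrameExtFn_of_ball`**: the door's `hMl` hypothesis (graded table, orders
  `1…4`, plus the order-`0` value bound `|mean f| + G₀`) on the whole `r`-ball from three numbers at the CENTRE (`|ε(x)−μ| + 4r < klFlatR`,
  `|xᵢ| + r < π`, `ρ + r ≤ ‖x‖`).

Pure real analysis + bookkeeping; no definitions; nothing about the model; nothing here asserts superconductivity.
-/

noncomputable section

namespace Summit.HubbardSuperconductivity.HubbardSuperconductivity.Theorems.KLRegimeSplit

set_option linter.dupNamespace false -- summit = problem name (single-conjunct summit), D-0017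

open Real MeasureTheory Filter Complex
open Literature.Analysis.Fourier.TrigApprox Literature.MathematicalPhysics.QuantumLattice Literature.Analysis.SpecialFunctions
open Summit.HubbardSuperconductivity.HubbardSuperconductivity.Theorems.PerturbedFermiCurve


/-! ## §1 Sharper local sizes: the `Θ`-form (choose `Θ` with `(i−1)!/‖y‖ⁱ ≤ Θⁱ`, e.g. `Θ⁴ = 6/ρ⁴` at order four — `24·6·G/ρ⁴`
instead of the radius form's `24·(3!/ρ)⁴·G`) -/

section NearTheta

/-- **LOCAL SIZES OF THE G-EXTENSION NEAR THE CURVE, `Θ`-form**: as `norm_iteratedFDeriv_onM_klFrameExtFn_le_near`, but with the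
argument-jet hypothesis `(i−1)!/‖y‖ⁱ ≤ Θⁱ` (`1 ≤ i ≤ n`) of k3c3-p1's `norm_iteratedFDeriv_comp_polarAngle_le`: `‖Dⁿ(onM (klFrameExtFn μ f))(y)‖ ≤ n!·G·Θⁿ`.
At order `4` with `‖y‖ ≥ ρ` the choice `Θ⁴ = 6/ρ⁴` is admissible (`1/ρ ≤ Θ`, `1/ρ² ≤ Θ²`, `2/ρ³ ≤ Θ³`), giving `144·G/ρ⁴` (the radius form gives `31104·G/ρ⁴`). -/
theorem norm_iteratedFDeriv_onM_klFrameExtFn_le_near_theta {f : ℝ → ℝ} {N : WithTop ℕ∞} (hf : ContDiff ℝ N f)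
    (hper : Function.Periodic f (2 * Real.pi)) {μ : ℝ} {y : Momentum}
    (htube : |sqDispersion (WithLp.ofLp y) - μ| < klFlatR) (hcell : ∀ i, |WithLp.ofLp y i| < π) (hy : y ≠ 0)
    {n : ℕ} (hn1 : 1 ≤ n) (hn : (n : WithTop ℕ∞) ≤ N) {G Θ : ℝ}
    (hG : ∀ i ≤ n, ∀ t : ℝ, ‖iteratedFDeriv ℝ i (fun t => f t - klAngularMean f) t‖ ≤ G)
    (hΘ : ∀ i, 1 ≤ i → i ≤ n → ((i - 1).factorial : ℝ) / ‖y‖ ^ i ≤ Θ ^ i) :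
    ‖iteratedFDeriv ℝ n (onM (klFrameExtFn μ f)) y‖ ≤ n.factorial * G * Θ ^ n := by
  have hloc := onM_klFrameExtFn_eventuallyEq_near μ f htube hcell
  rw [(hloc.iteratedFDeriv ℝ n).eq_of_nhds, iteratedFDeriv_const_add_of_one_le _ _ hn1]
  have hg : ContDiff ℝ N (fun t : ℝ => f t - klAngularMean f) := hf.sub contDiff_const
  have hgper : Function.Periodic (fun t : ℝ => f t - klAngularMean f) (2 * Real.pi) := fun t => by
    show f (t + 2 * Real.pi) - klAngularMean f = f t - klAngularMean f
    rw [hper t]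
  exact norm_iteratedFDeriv_comp_polarAngle_le hg hgper hy hn hG hΘ

/-- **Order four, radius form with the right constant**: for `‖y‖ ≥ ρ > 0`, `‖D⁴(onM (klFrameExtFn μ f))(y)‖ ≤ 144·G/ρ⁴`
(`= 4!·6/ρ⁴`; the Bell-graded truth is `(a₄ + 6a₃ + 11a₂ + 6a₁)/ρ⁴ ≤ 24·G/ρ⁴`). -/
theorem norm_iteratedFDeriv_four_onM_klFrameExtFn_le_near {f : ℝ → ℝ} {N : WithTop ℕ∞} (hf : ContDiff ℝ N f)
    (hper : Function.Periodic f (2 * Real.pi)) {μ : ℝ} {y : Momentum}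
    (htube : |sqDispersion (WithLp.ofLp y) - μ| < klFlatR) (hcell : ∀ i, |WithLp.ofLp y i| < π)
    {ρ : ℝ} (hρ : 0 < ρ) (hρy : ρ ≤ ‖y‖) (hn : (4 : WithTop ℕ∞) ≤ N) {G : ℝ}
    (hG : ∀ i ≤ 4, ∀ t : ℝ, ‖iteratedFDeriv ℝ i (fun t => f t - klAngularMean f) t‖ ≤ G) :
    ‖iteratedFDeriv ℝ 4 (onM (klFrameExtFn μ f)) y‖ ≤ 144 * G / ρ ^ 4 := by
  have hypos : 0 < ‖y‖ := hρ.trans_le hρy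
  have hy : y ≠ 0 := by intro h; rw [h, norm_zero] at hypos; exact lt_irrefl _ hypos
  have hG0 : 0 ≤ G := (norm_nonneg _).trans (hG 0 (by norm_num) 0)
  -- Θ := (6)^{1/4}/‖y‖ realised as Θ ^ 4 = 6/‖y‖⁴ via Θ = Real.sqrt (Real.sqrt 6) / ‖y‖
  set Θ : ℝ := Real.sqrt (Real.sqrt 6) / ‖y‖ with hΘdef
  have hs6 : Real.sqrt 6 ^ 2 = 6 := Real.sq_sqrt (by norm_num)
  have hss : Real.sqrt (Real.sqrt 6) ^ 2 = Real.sqrt 6 := Real.sq_sqrt (Real.sqrt_nonneg _)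
  have hss4 : Real.sqrt (Real.sqrt 6) ^ 4 = 6 := by nlinarith [hss, hs6]
  have hs6_ge : (2 : ℝ) ≤ Real.sqrt 6 := by
    rw [show (2 : ℝ) = Real.sqrt 4 by rw [show (4:ℝ) = 2 ^ 2 by norm_num, Real.sqrt_sq (by norm_num)]]
    exact Real.sqrt_le_sqrt (by norm_num)
  have hss_ge : (1 : ℝ) ≤ Real.sqrt (Real.sqrt 6) := by
    rw [show (1 : ℝ) = Real.sqrt 1 by simp]; exact Real.sqrt_le_sqrt (by linarith)
  have hΘpos : 0 < Θ := by positivity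
  have hΘ : ∀ i, 1 ≤ i → i ≤ 4 → ((i - 1).factorial : ℝ) / ‖y‖ ^ i ≤ Θ ^ i := by
    intro i hi1 hi4
    rw [hΘdef, div_pow, div_le_div_iff_of_pos_right (by positivity)]
    interval_cases i
    · simp only [Nat.sub_self, Nat.factorial_zero, Nat.cast_one, pow_one]; exact hss_ge
    · simp only [Nat.add_one_sub_one, Nat.factorial_one, Nat.cast_one, hss]; linarith
    · have : Real.sqrt (Real.sqrt 6) ^ 3 = Real.sqrt 6 * Real.sqrt (Real.sqrt 6) := by
        rw [pow_succ, hss]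
      rw [this]; norm_num [Nat.factorial]; nlinarith
    · rw [hss4]; norm_num [Nat.factorial]
  have h := norm_iteratedFDeriv_onM_klFrameExtFn_le_near_theta hf hper htube hcell hy (n := 4) (by norm_num) hn hG hΘ
  refine h.trans ?_
  rw [hΘdef, div_pow, hss4]
  have hy4 : ρ ^ 4 ≤ ‖y‖ ^ 4 := pow_le_pow_left₀ hρ.le hρy 4
  rw [show ((Nat.factorial 4 : ℕ) : ℝ) = 24 by norm_num [Nat.factorial]]
  rw [show (24 : ℝ) * G * (6 / ‖y‖ ^ 4) = 144 * G / ‖y‖ ^ 4 by ring]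
  exact div_le_div_of_nonneg_left (by positivity) (by positivity) hy4

end NearTheta

/-! ## §2 GRADED local sizes of the G-extension (Bell form, `…SplitCompGradedBounds`): `‖D⁴F(y)‖ ≤ (a₄ + 6a₃ + 11a₂ + 6a₁)/ρ⁴` etc. -/

section NearGraded

/-- Subtracting a constant does not change derivatives of positive order (norm form, one variable). -/
theorem norm_iteratedFDeriv_sub_const_of_one_le (f : ℝ → ℝ) (c : ℝ) {k : ℕ} (hk : 1 ≤ k) (t : ℝ) :
    ‖iteratedFDeriv ℝ k (fun s => f s - c) t‖ = ‖iteratedFDeriv ℝ k f t‖ := by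
  rw [show (fun s => f s - c) = fun s => -c + f s by funext s; ring, iteratedFDeriv_const_add_of_one_le _ _ hk]

/-- **GRADED LOCAL SIZES OF THE G-EXTENSION NEAR THE CURVE** (the door's `Ml`, Bell form): at a point `y` of the open flat tube inside the open
centred cell with `‖y‖ ≥ ρ > 0`, for `f` `C⁴`, `2π`-periodic with `‖Dᵏf‖ ≤ a k` (`1 ≤ k ≤ 4`; the mean drops out of every positive order):
`‖D¹F(y)‖ ≤ a₁/ρ`, `‖D²F(y)‖ ≤ (a₂ + a₁)/ρ²`, `‖D³F(y)‖ ≤ (a₃ + 3a₂ + 2a₁)/ρ³`, `‖D⁴F(y)‖ ≤ (a₄ + 6a₃ + 11a₂ + 6a₁)/ρ⁴`, `F = onM (klFrameExtFn μ f)`. -/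
theorem norm_iteratedFDeriv_onM_klFrameExtFn_le_near_graded {f : ℝ → ℝ} (hf : ContDiff ℝ 4 f)
    (hper : Function.Periodic f (2 * Real.pi)) {μ : ℝ} {y : Momentum}
    (htube : |sqDispersion (WithLp.ofLp y) - μ| < klFlatR) (hcell : ∀ i, |WithLp.ofLp y i| < π)
    {ρ : ℝ} (hρ : 0 < ρ) (hρy : ρ ≤ ‖y‖) {a : ℕ → ℝ} (ha : ∀ k, 1 ≤ k → k ≤ 4 → ∀ t : ℝ, ‖iteratedFDeriv ℝ k f t‖ ≤ a k) :
    ‖iteratedFDeriv ℝ 1 (onM (klFrameExtFn μ f)) y‖ ≤ a 1 / ρ ∧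
    ‖iteratedFDeriv ℝ 2 (onM (klFrameExtFn μ f)) y‖ ≤ (a 2 + a 1) / ρ ^ 2 ∧
    ‖iteratedFDeriv ℝ 3 (onM (klFrameExtFn μ f)) y‖ ≤ (a 3 + 3 * a 2 + 2 * a 1) / ρ ^ 3 ∧
    ‖iteratedFDeriv ℝ 4 (onM (klFrameExtFn μ f)) y‖ ≤ (a 4 + 6 * a 3 + 11 * a 2 + 6 * a 1) / ρ ^ 4 := by
  have hloc := onM_klFrameExtFn_eventuallyEq_near μ f htube hcell
  have hred : ∀ n, 1 ≤ n → iteratedFDeriv ℝ n (onM (klFrameExtFn μ f)) y =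
      iteratedFDeriv ℝ n (fun q : Momentum => (fun t => f t - klAngularMean f) (polarAngle (WithLp.ofLp q))) y := by
    intro n hn
    rw [(hloc.iteratedFDeriv ℝ n).eq_of_nhds, iteratedFDeriv_const_add_of_one_le _ _ hn]
  have hg : ContDiff ℝ 4 (fun t : ℝ => f t - klAngularMean f) := hf.sub contDiff_const
  have hgper : Function.Periodic (fun t : ℝ => f t - klAngularMean f) (2 * Real.pi) := fun t => by
    show f (t + 2 * Real.pi) - klAngularMean f = f t - klAngularMean f
    rw [hper t]
  have hb : ∀ k, 1 ≤ k → k ≤ 4 → ∀ t : ℝ, ‖iteratedFDeriv ℝ k (fun t : ℝ => f t - klAngularMean f) t‖ ≤ a k := by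
    intro k hk1 hk4 t
    rw [norm_iteratedFDeriv_sub_const_of_one_le f _ hk1]
    exact ha k hk1 hk4 t
  obtain ⟨g1, g2, g3, g4⟩ := norm_iteratedFDeriv_comp_polarAngle_le_graded hg hgper hρ hρy hb
  exact ⟨by rw [hred 1 le_rfl]; exact g1, by rw [hred 2 (by norm_num)]; exact g2, by rw [hred 3 (by norm_num)]; exact g3,
    by rw [hred 4 (by norm_num)]; exact g4⟩

end NearGraded

/-! ## §3 Ball geometry: the `r`-ball about a curve point lies in the open flat tube / open cell / off the origin -/

section Ball

/-- `‖D(ε∘ofLp)(z)‖ ≤ 4` as an operator norm (from `norm_iteratedFDeriv_sqDispersion_ofLp_le 1`). -/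
theorem norm_fderiv_sqDispersion_ofLp_le (z : Momentum) : ‖fderiv ℝ (fun q : Momentum => sqDispersion (WithLp.ofLp q)) z‖ ≤ 4 := by
  have h := norm_iteratedFDeriv_sqDispersion_ofLp_le 1 z
  have e := norm_iteratedFDeriv_fderiv (𝕜 := ℝ) (f := fun q : Momentum => sqDispersion (WithLp.ofLp q)) (x := z) (n := 0)
  rw [norm_iteratedFDeriv_zero] at e
  rw [e]; exact h

/-- **Ball in the flat tube**: if `|ε(x) − μ| + 4r < klFlatR` then every `y` with `‖y − x‖ ≤ r` has `|ε(y) − μ| < klFlatR`. -/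
theorem abs_sqDispersion_sub_lt_of_ball {μ r : ℝ} {x y : Momentum} (hy : ‖y - x‖ ≤ r)
    (h : |sqDispersion (WithLp.ofLp x) - μ| + 4 * r < klFlatR) : |sqDispersion (WithLp.ofLp y) - μ| < klFlatR := by
  have hdiff : ∀ z ∈ (Set.univ : Set Momentum), DifferentiableAt ℝ (fun q : Momentum => sqDispersion (WithLp.ofLp q)) z := fun z _ =>
    (contDiff_sqDispersion_ofLp (N := 1)).differentiable (by norm_num) z
  have hmv := (convex_univ).norm_image_sub_le_of_norm_fderiv_le hdiff (fun z _ => norm_fderiv_sqDispersion_ofLp_le z)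
    (Set.mem_univ x) (Set.mem_univ y)
  rw [Real.norm_eq_abs] at hmv
  have htri : |sqDispersion (WithLp.ofLp y) - μ| ≤ |sqDispersion (WithLp.ofLp x) - μ| +
      |sqDispersion (WithLp.ofLp y) - sqDispersion (WithLp.ofLp x)| := by
    have := abs_add_le (sqDispersion (WithLp.ofLp x) - μ) (sqDispersion (WithLp.ofLp y) - sqDispersion (WithLp.ofLp x))
    have e : sqDispersion (WithLp.ofLp x) - μ + (sqDispersion (WithLp.ofLp y) - sqDispersion (WithLp.ofLp x)) =
        sqDispersion (WithLp.ofLp y) - μ := by ring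
    rw [e] at this; exact this
  have hr : 0 ≤ r := (norm_nonneg _).trans hy
  nlinarith [hmv, htri, mul_le_mul_of_nonneg_left hy (by norm_num : (0:ℝ) ≤ 4)]

/-- **Ball in the open centred cell**: `|xᵢ| + r < π` for both coordinates ⇒ every `y` with `‖y − x‖ ≤ r` has `|yᵢ| < π`. -/
theorem abs_coord_lt_pi_of_ball {r : ℝ} {x y : Momentum} (hy : ‖y - x‖ ≤ r) (h : ∀ i, |WithLp.ofLp x i| + r < π) (i : Fin 2) :
    |WithLp.ofLp y i| < π := by
  have hc : |WithLp.ofLp (y - x) i| ≤ ‖y - x‖ := by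
    have := PiLp.norm_apply_le (y - x) i
    rwa [Real.norm_eq_abs] at this
  have e : WithLp.ofLp (y - x) i = WithLp.ofLp y i - WithLp.ofLp x i := rfl
  rw [e] at hc
  have := abs_sub_abs_le_abs_sub (WithLp.ofLp y i) (WithLp.ofLp x i)
  linarith [h i]

/-- **Ball off the origin**: `ρ + r ≤ ‖x‖` ⇒ every `y` with `‖y − x‖ ≤ r` has `ρ ≤ ‖y‖`. -/
theorem le_norm_of_ball {r ρ : ℝ} {x y : Momentum} (hy : ‖y - x‖ ≤ r) (h : ρ + r ≤ ‖x‖) : ρ ≤ ‖y‖ := by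
  have := norm_sub_norm_le x y
  rw [norm_sub_rev] at this
  linarith

end Ball

/-! ## §4 The door's `hMl` hypothesis on the whole ball from three numbers at the centre -/

section BallSizes

/-- **LOCAL SIZES ON THE BALL** (the `hMl` hypothesis of `flowPiece_reading_remainder_jets` / `jacksonRemainder_curve_jets`, graded table):
for `f` `C⁴`, `2π`-periodic with `‖Dᵏf‖ ≤ a k` (`1 ≤ k ≤ 4`) and `|f t − mean f| ≤ G₀`, `μ ∈ klWindowC`, and a centre `x` with
`|ε(x) − μ| + 4r < klFlatR`, `|xᵢ| + r < π`, `ρ + r ≤ ‖x‖` (`ρ > 0`): for every `y` with `‖y − x‖ ≤ r` and every `i ≤ 4`,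
`‖Dⁱ(onM (klFrameExtFn μ f))(y)‖ ≤ Ml i` with `Ml 0 = |mean f| + G₀`, `Ml 1 = a₁/ρ`, `Ml 2 = (a₂+a₁)/ρ²`, `Ml 3 = (a₃+3a₂+2a₁)/ρ³`,
`Ml 4 = (a₄+6a₃+11a₂+6a₁)/ρ⁴`. -/
theorem localSizes_onM_klFrameExtFn_of_ball {f : ℝ → ℝ} (hf : ContDiff ℝ 4 f) (hper : Function.Periodic f (2 * Real.pi)) {μ : ℝ}
    {x : Momentum} {r ρ : ℝ} (hρ : 0 < ρ) (htube : |sqDispersion (WithLp.ofLp x) - μ| + 4 * r < klFlatR)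
    (hcell : ∀ i, |WithLp.ofLp x i| + r < π) (hrad : ρ + r ≤ ‖x‖) {a : ℕ → ℝ}
    (ha : ∀ k, 1 ≤ k → k ≤ 4 → ∀ t : ℝ, ‖iteratedFDeriv ℝ k f t‖ ≤ a k) {G₀ : ℝ} (hG₀ : ∀ t : ℝ, |f t - klAngularMean f| ≤ G₀)
    {i : ℕ} (hi : i ≤ 4) (y : Momentum) (hy : ‖y - x‖ ≤ r) :
    ‖iteratedFDeriv ℝ i (onM (klFrameExtFn μ f)) y‖ ≤
      (fun i : ℕ => match i with
        | 0 => |klAngularMean f| + G₀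
        | 1 => a 1 / ρ
        | 2 => (a 2 + a 1) / ρ ^ 2
        | 3 => (a 3 + 3 * a 2 + 2 * a 1) / ρ ^ 3
        | _ => (a 4 + 6 * a 3 + 11 * a 2 + 6 * a 1) / ρ ^ 4) i := by
  have hyt := abs_sqDispersion_sub_lt_of_ball hy htube
  have hyc := abs_coord_lt_pi_of_ball hy hcell
  have hyr := le_norm_of_ball hy hrad
  obtain ⟨g1, g2, g3, g4⟩ := norm_iteratedFDeriv_onM_klFrameExtFn_le_near_graded hf hper hyt hyc hρ hyr ha
  interval_cases i
  · -- the value: `|mean + 1·(f(angle) − mean)|`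
    show ‖iteratedFDeriv ℝ 0 (onM (klFrameExtFn μ f)) y‖ ≤ |klAngularMean f| + G₀
    rw [norm_iteratedFDeriv_zero, Real.norm_eq_abs]
    have hloc := (onM_klFrameExtFn_eventuallyEq_near μ f hyt hyc).eq_of_nhds
    rw [hloc]
    exact (abs_add_le _ _).trans (add_le_add le_rfl (hG₀ _))
  · exact g1
  · exact g2
  · exact g3
  · exact g4

end BallSizes

end Summit.HubbardSuperconductivity.HubbardSuperconductivity.Theorems.KLRegimeSplit

end
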